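import Summits.BirchSwinnertonDyer.BirchSwinnertonDyer.Theorems.UniversalToricDescentTwinReadoutLocalIndexThree
import Summits.BirchSwinnertonDyer.BirchSwinnertonDyer.Theorems.UniversalToricDescentTwinReadoutKummerStrictAtThree
import HarnessLib

/-!
# (B5-P) at a multiplicative `v ∣ 3`, UNCONDITIONAL: g25's per-place readout index bound with its (hS′) input discharged
# (helper, THEOREMS ONLY: no definition, no named fact, no instance, no `sorry`)

LEAD `bsd-wall-utd-p1` (g26), crux r205 stmt-BirchSwinnertonDyer-24737 `…Theses.UniversalToricDescent.TwinAlgMuZeroAtThree`, line `beta-road` v10,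
K2 stub `stub_howardOutputsOfFamily`, D1-twin readout side.  Composition of two landed helpers: p762007
(`…TwinReadoutLocalIndexThree.readoutLocalIndexThree_at_of_hasMultiplicativeReductionAt`, (B5-P) at a multiplicative `v ∣ 3` GIVEN the
(hS′) input `hSv`) and p763643 (`…TwinReadoutKummerStrictAtThree.exists_quotient_cocycle_principal_…_of_hasMultiplicativeReductionAt_three`,
(hS′) at a multiplicative `v ∣ 3` with KS(v) proved).  Result: the second place-wise clause of x10b's `readoutIndex_of_localClauses` for
the twin at `v ∣ 3`, with NO local hypothesis beyond multiplicative reduction.  No summit statement is proved; BSD is not proved by any of this.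
-/

set_option linter.dupNamespace false
set_option autoImplicit false

noncomputable section

open scoped Classical Pointwise ContRepresentation TensorProduct NumberField

open Function NumberField IsDedekindDomain Field
open Literature Literature.NumberTheory.EllipticCurves WeierstrassCurve
open Literature.NumberTheory.GaloisCohomology Literature.NumberTheory.GaloisCohomology.Howard2004
open Literature.NumberTheory.GaloisRepresentations Literature.NumberTheory.GaloisRepresentations.DiscreteGaloisModule
open Literature.NumberTheory.EllipticCurves.GreenbergSelmer
open Summit.BirchSwinnertonDyer.BirchSwinnertonDyer.Theorems
open Literature.NumberTheory.EllipticCurves.ZpExtension (EisensteinLevel)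
open Summit.BirchSwinnertonDyer.BirchSwinnertonDyer.Theorems.UniversalToricDescentTwinReadoutLocalIndexThree
open Summit.BirchSwinnertonDyer.BirchSwinnertonDyer.Theorems.UniversalToricDescentTwinReadoutKummerStrictAtThree

namespace Summit.BirchSwinnertonDyer.BirchSwinnertonDyer.Theorems.UniversalToricDescentTwinReadoutLocalIndexThreeUnconditional

set_option maxHeartbeats 800000 in
/-- **(B5-P) at one multiplicative place `v ∣ 3` and one level `j`, UNCONDITIONALLY** — g25's
`readoutLocalIndexThree_at_of_hasMultiplicativeReductionAt` (p762007) with its (hS′) input `hSv` DISCHARGED by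
`UniversalToricDescentTwinReadoutKummerStrictAtThree.exists_quotient_cocycle_principal_of_eisensteinTowerReadout_mem_selmerInfty_of_hasMultiplicativeReductionAt_three`
(p763643: KS(v) at a multiplicative `v ∣ 3` is a theorem): the relaxed condition `Fv` contains `loc_v c` for every class `c` whose readout lies
in `Sel_{3^∞}(E/K_∞)` and `#(Fv ⧸ condA F j v ∩ Fv) ≤ 3^{2·3^s}`.
[cite: Howard2004HeegnerKolyvagin, Lemma 2.2.7 / Prop. 2.2.8, Lemma 3.2.7 and proof of Thm. 2.2.10 (arXiv:1202.6340 p. 16–18)]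
[cite: GreenbergLNM1716, §2–§3] [cite: MilneADT2006, I Cor. 2.3] -/
theorem readoutLocalIndexThree_at_of_hasMultiplicativeReductionAt_unconditional {K : Type} [Field K] [NumberField K]
    (W : WeierstrassCurve ℚ) [W.IsElliptic] (κ : ZpExtension K 3) {γ : absoluteGaloisGroup K} (hγ : κ.IsTopGenerator γ)
    {m : ℕ} (hm : 1 ≤ m)
    (π : (IwasawaAlgebra 3 ⧸ Ideal.span {(PowerSeries.X ^ m + PowerSeries.C ((3 : ℕ) : ℤ_[3]) : IwasawaAlgebra 3)})) (e : ℕ → ℕ)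
    (hkill : letI := IwasawaAlgebra.isLocalRing_quotient_X_pow_add_C 3 hm
      ∀ k, ∀ r ∈ IsLocalRing.maximalIdeal (IwasawaAlgebra 3 ⧸ Ideal.span {(PowerSeries.X ^ m + PowerSeries.C ((3 : ℕ) : ℤ_[3]) : IwasawaAlgebra 3)}) ^ e k,
        ∀ x : EisensteinLevel 3 m (fun j ↦ geomTorsion (W.baseChange K) (((3 : ℕ) : ℤ) ^ j)) (k + 1), r • x = 0)
    (hker : letI := IwasawaAlgebra.isLocalRing_quotient_X_pow_add_C 3 hm
      ∀ k, LinearMap.ker ((W.eisensteinTower (κ.unitTwist (-1)) hm).red k) =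
        (IsLocalRing.maximalIdeal (IwasawaAlgebra 3 ⧸ Ideal.span {(PowerSeries.X ^ m + PowerSeries.C ((3 : ℕ) : ℤ_[3]) : IwasawaAlgebra 3)}) ^ e k) •
          (⊤ : Submodule (IwasawaAlgebra 3 ⧸ Ideal.span {(PowerSeries.X ^ m + PowerSeries.C ((3 : ℕ) : ℤ_[3]) : IwasawaAlgebra 3)}) (EisensteinLevel 3 m (fun j ↦ geomTorsion (W.baseChange K) (((3 : ℕ) : ℤ) ^ j)) (k + 1 + 1))))
    (hπ : letI := IwasawaAlgebra.isLocalRing_quotient_X_pow_add_C 3 hm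
      π ∈ IsLocalRing.maximalIdeal (IwasawaAlgebra 3 ⧸ Ideal.span {(PowerSeries.X ^ m + PowerSeries.C ((3 : ℕ) : ℤ_[3]) : IwasawaAlgebra 3)}))
    (he : ∀ k, e k ≤ e (k + 1)) (hπX : π = Ideal.Quotient.mk _ PowerSeries.X) (hek : ∀ k, e (k + 1) - e k = m)
    (F : letI := IwasawaAlgebra.isLocalRing_quotient_X_pow_add_C 3 hm
      ∀ k, SelmerStructure ((W.eisensteinTower (κ.unitTwist (-1)) hm).ρ k))
    (v : HeightOneSpectrum (𝓞 K)) (hpv : ((3 : ℕ) : 𝓞 K) ∈ v.asIdeal) (hmult : (W.baseChange K).HasMultiplicativeReductionAt v)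
    (σ₀ : absoluteGaloisGroup (v.adicCompletion K)) {s : ℕ}
    (hσ₀ : ((κ.unitTwist (-1)) (absGaloisRestrict K (v.adicCompletion K) σ₀)).toAdd = ((3 ^ s : ℕ) : ℤ_[3]))
    (hms : 3 ^ s < m) (j : ℕ)
    (hF : letI := IwasawaAlgebra.isLocalRing_quotient_X_pow_add_C 3 hm
      ∀ k, F k (Sum.inr v) = Tower.levelCondition ((κ.unitTwist (-1)).eisensteinLocalReduce (fun i ↦ (W.baseChange K).torsionGaloisModule (((3 : ℕ) : ℤ) ^ i))
        (fun i ↦ (W.baseChange K).torsionGaloisModuleReduce 3 i) hm (Sum.inr v)) 3 (fun i ↦ ((W.baseChange K).ordinaryFiltrationAt v (fun i ↦ (W.baseChange K).torsionGaloisModuleReduce 3 i) (fun _ _ ↦ rfl)).ordinaryCore (κ := κ.unitTwist (-1)) hm i) (k + 1)) :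
    letI := IwasawaAlgebra.isLocalRing_quotient_X_pow_add_C 3 hm
    ∃ Fv : AddSubgroup (galoisCohomology (((W.eisensteinTower (κ.unitTwist (-1)) hm).ρ j).toLocal (Sum.inr v)) 1),
      (∀ c : galoisCohomology ((W.eisensteinTower (κ.unitTwist (-1)) hm).ρ j) 1,
        W.eisensteinTowerReadout κ hm π e hkill hker hπ he hπX hek
          (AddCommGroup.DirectLimit.of (fun k ↦ galoisCohomology ((W.eisensteinTower (κ.unitTwist (-1)) hm).ρ k) 1)
            (AdicTower.incH1LE (W.eisensteinTower (κ.unitTwist (-1)) hm) π e hkill hker hπ he) j c) ∈ (W.baseChange K).selmerInfty κ →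
          galoisCohomology.localization ((W.eisensteinTower (κ.unitTwist (-1)) hm).ρ j) (Sum.inr v) 1 c ∈ Fv) ∧
      Finite (↥Fv ⧸ (AdicTower.condA (W.eisensteinTower (κ.unitTwist (-1)) hm) π e hkill hker hπ he F j (Sum.inr v)).addSubgroupOf Fv) ∧
      Nat.card (↥Fv ⧸ (AdicTower.condA (W.eisensteinTower (κ.unitTwist (-1)) hm) π e hkill hker hπ he F j (Sum.inr v)).addSubgroupOf Fv) ≤ 3 ^ (2 * 3 ^ s) := by
  exact readoutLocalIndexThree_at_of_hasMultiplicativeReductionAt W κ hm π e hkill hker hπ he hπX hek F v hpv hmult σ₀ hσ₀ hms j hF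
    (exists_quotient_cocycle_principal_of_eisensteinTowerReadout_mem_selmerInfty_of_hasMultiplicativeReductionAt_three
      W κ hm π e hkill hker hπ he hπX hek hγ v hpv hmult)

end Summit.BirchSwinnertonDyer.BirchSwinnertonDyer.Theorems.UniversalToricDescentTwinReadoutLocalIndexThreeUnconditional

end
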